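import Summits.BirchSwinnertonDyer.BirchSwinnertonDyer.Theorems.SignedBaseChangeAnticyclotomicEisensteinDivisibilityControlCoker
import Summits.BirchSwinnertonDyer.BirchSwinnertonDyer.Theorems.SignedBaseChangeAnticyclotomicEisensteinDivisibilityAwayDiscrepancy
import Summits.BirchSwinnertonDyer.BirchSwinnertonDyer.Theorems.ResidualThetaTransportAtTwoRlfSharpEigenLocal
import Literature.NumberTheory.EllipticCurves.TwoVariableAnticyclotomicControl
import Literature.NumberTheory.EllipticCurves.HeegnerPointsKolyvaginTorsionProofs
import HarnessLib

/-!
# Exact control from the `ℤ_p²`-tower to the anticyclotomic line, REDUCED TO ONE LOCAL VANISHING: the restriction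
# `Sel_{v̄}^∅(K_∞^{(2)}, E[p^∞]) → H¹_{nr,v̄}(K̃_∞, E[p^∞])^{γ₁ = 1}` is onto up to `p^m` as soon as `E[p^∞]` has no non-zero
# point fixed by the inertia group of `K̃_∞` at `v̄` (helper for cruxes `GordTwoRankZeroOffCaseOne` stmt-BirchSwinnertonDyer-19357 /
# `MultLower` stmt-19359, lines `three_field_road` / `tame_roads_mult` v18, stub `stub_tameExactControl{R0,M}`)

Lead seat cruxlead-19357 (gen 6). Skeleton v18 registered `stub_tameExactControl{R0,M}`: for the anticyclotomic `(κ, γ)` and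
`𝔭′ ∣ p`, a completion `(κ₁, γ₁)` to a topological generator pair and an exponent `m` with «every `conj_{γ₁}`-fixed class `s` of
`unrSelmer₂ κ₁ κ E[p^∞] 𝔭′` has `p^m·s ∈ range(selmerAcToUnrSelmer₂)`» (the finite-exponent-kernel input of the PROVED lower-bound
specialisation `TameSpecialization.S2L.charIdeal_XAc_map_le_span_of_twoVar`, p702507). This file PROVES that statement from the
tree MODULO ONE LOCAL VANISHING at `v̄` — the "tame miracle" of the additive prime (LeadReport12 §3): `E[p^∞]^{I} = 0` for
`I = Gal(K̄/K̃_∞) ∩ I_{v̄}`. Pieces (Skinner–Urban Prop. 3.2.8 / Jetchev–Skinner–Wan Lemma 3.4.1 in the `K_∞`-formulation):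

* §1 `mem_unramifiedKer_of_resOfLe_mem` — generic (`H ≤ H'` subgroups of `Γ_K`, discrete `M`): if `H' ∩ I_v ≤ H` (the two fields
  have THE SAME inertia group at `v`) then «`res y` unramified at `v` over `K̄^H`» ⟹ «`y` unramified at `v` over `K̄^{H'}`» (the two
  conditions are the same cocycle restricted to the same group).
* §2 `mem_strictKer_of_resOfLe_mem_greenbergKer` — generic datum `M⁺_v`: if `(M/M⁺_v)^{H ∩ I_v} = 0` then «`res y` satisfies
  Greenberg's INERTIA condition over `K̄^H`» ⟹ «`y` satisfies the STRICT (decomposition-group) condition over `K̄^{H'}`» — the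
  injectivity half of inflation–restriction for `H ∩ I_v ⊴ H' ∩ D_v` (tree `resOfLe_injective_of_forall_fixed_eq_zero`, normality
  `SignedEC.SharpEigen.inertiaIn_normal`); `…_strictDatum` — the case `M⁺_v = 0` from `M^{H ∩ I_v} = 0`.
* §3 `exists_pow_smul_mem_range_selmerAcToUnrSelmer₂` — for `W` elliptic over a number field `K` with all infinite places complex,
  `E(K)[p] = 0`, a generator pair `(κ₁, κ₂; γ₁, γ₂)`, `v̄ ∋ p`, and the local vanishing `E[p^∞]^{pairKer ∩ I_{v̄}} = 0`: there is `m`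
  with `p^m·s ∈ range(selmerAcToUnrSelmer₂)` for every `conj_{γ₁}`-fixed `s ∈ unrSelmer₂ κ₁ κ₂ E[p^∞] v̄`. GLOBAL descent by sbc-p1's
  `SignedBaseChangeAcDivControlCoker.exists_resOfLe_eq_of_conjSel₂_eq`; AWAY from `p` by §1 (`I_v ≤ ker κ₁`,
  `ZpExtension.inertia_le_kerSubgroup_holds`) and sbc-p1's integer `t` (`SignedBaseChangeAcDivAwayDiscrepancy.
  exists_nsmul_mem_selmerAc_of_mem_datumStrictSelmer`); AT `v̄` by §2; the prime-to-`p` part of `t` is removed on the `p`-primary class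
  (`exists_pow_smul_mem_of_nsmul_mem`, Bézout).
* §4 `tameExactControl_of_localVanishing` — the `ℚ`-curve form with the binders of the skeletons' `TameExactControlAt W p K` at a
  given pair: `Surj W p`, `p ≠ 2`, `K` imaginary quadratic (`E(K)[p] = 0` by `torsionBy_eq_bot_of_isImaginaryQuadratic`).

Galois-cohomological bookkeeping on the tree's CONSTRUCTED carriers; no definition, no named fact, no `sorry`. The local
vanishing itself (for `E = V ⊗ χ_{p*}`, `V` ordinary or multiplicative at `p ≥ 5`: `E[p]|_{I_p}^{ss} = ω^{(p+1)/2} ⊕ ω^{(p−1)/2}`) is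
NOT proved here. BSD is not proved by any of this.
References: Skinner–Urban, Invent. Math. 195 (2014) §3.2.7–3.2.8; Jetchev–Skinner–Wan, Camb. J. Math. 5 (2017) §3.4 (arXiv:1512.06894
pp. 14–15); Greenberg, LNM 1716 (1999) §3 Lemmas 3.1–3.3; Serre, *Local Fields* VII §6 Prop. 4.
-/

-- D-0017: single-problem summit, the namespace repeats the problem name by design.
set_option linter.dupNamespace false
set_option autoImplicit false

noncomputable section

open scoped Classical

open NumberField IsDedekindDomain Field
open Literature.NumberTheory.EllipticCurves Literature.NumberTheory.GaloisRepresentations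
  Literature.NumberTheory.EllipticCurves.GreenbergSelmer Literature.NumberTheory.EllipticCurves.GreenbergVatsal2000
  Literature.NumberTheory.EllipticCurves.Castella2018

namespace Summit.BirchSwinnertonDyer.BirchSwinnertonDyer.Theorems.TameExactControl

/-! ## §1. Same inertia group ⟹ unramifiedness descends along restriction -/

section Unramified

variable {K : Type} [Field K] [NumberField K]
  {M : Type} [AddCommGroup M] [DistribMulAction (absoluteGaloisGroup K) M] [TopologicalSpace M]
  [DiscreteTopology M]

/-- **Unramifiedness descends when the inertia groups agree.** For `H ≤ H' ≤ Γ_K` and a finite place `v` with `H' ∩ I_v ≤ H`: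
if `res y ∈ H¹(H, M)` is unramified at `v` (dies on `H ∩ I_v`) then `y ∈ H¹(H', M)` is unramified at `v` (dies on `H' ∩ I_v` —
the same group, the same cocycle, the same coboundary). Used with `H = Gal(K̄/K̃_∞) ≤ H' = Gal(K̄/K_∞^{(2)})` at `v ∤ p`, where
`ℤ_p`-extensions are unramified. [cite: GreenbergVatsal2000, §2 p. 17] [cite: Washington1997, Prop. 13.2] -/
theorem mem_unramifiedKer_of_resOfLe_mem {H H' : Subgroup (absoluteGaloisGroup K)} (hle : H ≤ H')
    (v : HeightOneSpectrum (𝓞 K)) (hI : H' ⊓ inertia v ≤ H) {y : subgroupH1 H' M}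
    (h : resOfLe M hle y ∈ GreenbergVatsal2000.unramifiedKer H M v) :
    y ∈ GreenbergVatsal2000.unramifiedKer H' M v := by
  obtain ⟨z, rfl⟩ := oneCocycleClass_surjective _ y
  rw [GreenbergVatsal2000.unramifiedKer, AddMonoidHom.mem_ker, ← AddMonoidHom.comp_apply, resOfLe, resH1Hom_comp,
    CocycleCriteria.resH1Hom_oneCocycleClass_eq_zero_iff] at h
  obtain ⟨a, ha⟩ := h
  rw [GreenbergVatsal2000.unramifiedKer, AddMonoidHom.mem_ker, CocycleCriteria.resH1Hom_oneCocycleClass_eq_zero_iff]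
  refine ⟨a, fun x ↦ ?_⟩
  have hx := (mem_inertiaIn_iff H' v x).1 x.2
  have hxH : ((x : decomp (K := K) v) : absoluteGaloisGroup K) ∈ H := hI ⟨hx.1, hx.2⟩
  exact ha ⟨(x : decomp (K := K) v), (mem_inertiaIn_iff H v _).2 ⟨hxH, hx.2⟩⟩

end Unramified

/-! ## §2. No inertia-fixed points ⟹ the Greenberg (inertia) condition over `K̄^H` gives the STRICT condition over `K̄^{H'}` -/

section Strict

variable {K : Type} [Field K] [NumberField K]
  {M : Type} [AddCommGroup M] [DistribMulAction (absoluteGaloisGroup K) M] [TopologicalSpace M]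
  [DiscreteTopology M]

/-- **Restriction of the strict map equals the Greenberg map of the restriction**: for `H ≤ H'` and a datum `M⁺_v`,
`res_{H ∩ I_v}(strictMap_{H'} y) = greenbergMap_H(res_{H} y)` in `H¹(H ∩ I_v, M/M⁺_v)` (both are induced by the compatible pair
`(H ∩ I_v ↪ H', M ↠ M/M⁺_v)`). [cite: Greenberg1989, §1 p. 98 (4)] -/
theorem resOfLe_strictMap_eq_greenbergMap_resOfLe {H H' : Subgroup (absoluteGaloisGroup K)} (hle : H ≤ H')
    {v : HeightOneSpectrum (𝓞 K)} (N : LocalDatum K M v) (y : subgroupH1 H' M) :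
    resOfLe N.Gr ((inertiaIn_le_decompIn H v).trans
        (fun x hx ↦ (mem_decompIn_iff H' v x).2 (hle ((mem_decompIn_iff H v x).1 hx))))
      (N.strictMap H' y) = N.greenbergMap H (resOfLe M hle y) := by
  rw [← AddMonoidHom.comp_apply, ← AddMonoidHom.comp_apply, LocalDatum.strictMap, resOfLe, resH1Hom_comp,
    LocalDatum.greenbergMap, resOfLe, resH1Hom_comp]
  exact congrFun (congrArg DFunLike.coe (resH1Hom_congr (ContinuousMonoidHom.ext fun _ ↦ rfl)
    (by ext; rfl) _ _)) y

/-- **Greenberg over `K̄^H` ⟹ strict over `K̄^{H'}` when `(M/M⁺_v)^{H ∩ I_v} = 0`** (`H ≤ H'`, `H ⊴ Γ_K`): if the restriction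
`res y ∈ H¹(H, M)` of `y ∈ H¹(H', M)` satisfies Greenberg's inertia condition at `v` (dies in `H¹(H ∩ I_v, M/M⁺_v)`) and `M/M⁺_v` has
no non-zero point fixed by `H ∩ I_v`, then `y` satisfies the STRICT condition at `v` (dies in `H¹(H' ∩ D_v, M/M⁺_v)`): the restriction
`H¹(H' ∩ D_v, M/M⁺_v) → H¹(H ∩ I_v, M/M⁺_v)` is injective by inflation–restriction (`H ∩ I_v ⊴ D_v`, no fixed points).
[cite: SkinnerUrban2014, Prop. 3.2.8 (p. 23)] [cite: GreenbergLNM1716, §3 Lemma 3.1] [cite: SerreLocalFields1979, VII §6 Prop. 4] -/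
theorem mem_strictKer_of_resOfLe_mem_greenbergKer {H H' : Subgroup (absoluteGaloisGroup K)} [H.Normal] (hle : H ≤ H')
    {v : HeightOneSpectrum (𝓞 K)} (N : LocalDatum K M v)
    (hfix : ∀ g : N.Gr, (∀ x : decomp (K := K) v, x ∈ inertiaIn H v → x • g = g) → g = 0)
    {y : subgroupH1 H' M} (h : resOfLe M hle y ∈ N.greenbergKer H) : y ∈ N.strictKer H' := by
  haveI : (inertiaIn H v).Normal := SignedEC.SharpEigen.inertiaIn_normal H v
  have hι : inertiaIn H v ≤ decompIn H' v := (inertiaIn_le_decompIn H v).trans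
    (fun x hx ↦ (mem_decompIn_iff H' v x).2 (hle ((mem_decompIn_iff H v x).1 hx)))
  have hinj := resOfLe_injective_of_forall_fixed_eq_zero (M := N.Gr) hι hfix
  rw [LocalDatum.mem_strictKer_iff]
  apply hinj
  rw [map_zero, resOfLe_strictMap_eq_greenbergMap_resOfLe hle N y]
  exact (LocalDatum.mem_greenbergKer_iff H N _).1 h

/-- The case `M⁺_v = 0` (Castella's STRICT datum): if `M` has no non-zero point fixed by `H ∩ I_v`, then Greenberg's inertia
condition for `res y` over `K̄^H` implies the strict condition for `y` over `K̄^{H'}`.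
[cite: SkinnerUrban2014, Prop. 3.2.8 (p. 23)] [cite: Castella2018, Def. 2.2 (arXiv:1704.06608 p. 5)] -/
theorem mem_strictKer_strictDatum_of_resOfLe_mem_greenbergKer {H H' : Subgroup (absoluteGaloisGroup K)} [H.Normal]
    (hle : H ≤ H') (v : HeightOneSpectrum (𝓞 K))
    (hfix : ∀ m : M, (∀ x : absoluteGaloisGroup K, x ∈ H → x ∈ inertia v → x • m = m) → m = 0)
    {y : subgroupH1 H' M} (h : resOfLe M hle y ∈ (AcSelmer.strictDatum M v).greenbergKer H) :
    y ∈ (AcSelmer.strictDatum M v).strictKer H' := by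
  refine mem_strictKer_of_resOfLe_mem_greenbergKer hle _ (fun g hg ↦ ?_) h
  obtain ⟨m, rfl⟩ := (AcSelmer.strictDatum M v).grMk_surjective g
  have hm : m = 0 := by
    refine hfix m fun x hxH hxI ↦ ?_
    have hxD : x ∈ decomp (K := K) v := inertia_le_decomp v hxI
    have h1 := hg ⟨x, hxD⟩ ((mem_inertiaIn_iff H v _).2 ⟨hxH, hxI⟩)
    rw [LocalDatum.smul_grMk, ← sub_eq_zero, ← map_sub, ← AddMonoidHom.mem_ker, LocalDatum.ker_grMk] at h1
    change x • m - m ∈ (⊥ : AddSubgroup M) at h1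
    rw [AddSubgroup.mem_bot, sub_eq_zero] at h1
    exact h1
  rw [hm, map_zero]

end Strict

/-! ## §3. The `ℤ_p²`-tower over the anticyclotomic line: control up to `p^m` from the local vanishing at `v̄` -/

section Tower

variable {K : Type} [Field K] [NumberField K] (W : WeierstrassCurve K) [W.IsElliptic] (p : ℕ) [Fact p.Prime]
  (κ₁ κ₂ : ZpExtension K p) (vbar : HeightOneSpectrum (𝓞 K)) {γ₁ γ₂ : absoluteGaloisGroup K}

/-- **Bézout on a `p`-primary element**: if `t ≠ 0` and `t • s` lies in an additive subgroup `R`, and `p^k • s = 0`, then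
`p^{v_p(t)} • s ∈ R` (the prime-to-`p` part of `t` is invertible modulo `p^k`). [folklore] -/
theorem exists_pow_smul_mem_of_nsmul_mem {A : Type*} [AddCommGroup A] (R : AddSubgroup A) {s : A} {t k : ℕ}
    (ht : t ≠ 0) (hk : p ^ k • s = 0) (hts : t • s ∈ R) : p ^ (t.factorization p) • s ∈ R := by
  have hp : p.Prime := Fact.out
  set a := t.factorization p with ha
  have htt : p ^ a * (t / p ^ a) = t := Nat.ordProj_mul_ordCompl_eq_self t p
  set t' := t / p ^ a with ht'
  have hcop : Nat.Coprime p t' := Nat.coprime_ordCompl hp ht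
  have hcop' : Nat.Coprime t' (p ^ k) := Nat.Coprime.pow_right k hcop.symm
  by_cases hk1 : p ^ k = 1
  · rw [hk1, one_smul] at hk
    rw [hk, smul_zero]
    exact R.zero_mem
  have h1 : 1 < p ^ k := by
    have := Nat.one_le_pow k p hp.pos
    omega
  obtain ⟨u, -, hu⟩ := Nat.exists_mul_mod_eq_one_of_coprime hcop' h1
  -- `t' * u = p^k * q + 1`
  set q := t' * u / p ^ k with hqdef
  have hq : t' * u = p ^ k * q + 1 := by
    have e := (Nat.div_add_mod (t' * u) (p ^ k)).symm
    rwa [hu] at e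
  have hut : u * t = (q * p ^ a) * p ^ k + p ^ a := by
    rw [← htt]
    have e : u * (p ^ a * t') = p ^ a * (t' * u) := by ring
    rw [e, hq]
    ring
  have key : u • (t • s) = p ^ a • s := by
    rw [← mul_nsmul', hut, add_nsmul, mul_nsmul', hk, smul_zero, zero_add]
  rw [← key]
  exact R.nsmul_mem hts u

/-- **CONTROL UP TO `p^m` FROM THE LOCAL VANISHING AT `v̄`.** Let `W` be elliptic over a number field `K` all of whose infinite
places are complex, `E(K)[p] = 0`, `(κ₁, κ₂; γ₁, γ₂)` a topological generator pair of `ℤ_p`-extensions, `v̄ ∋ p`, and suppose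
`E[p^∞]` has NO non-zero point fixed by `Gal(K̄/K̃_∞) ∩ I_{v̄}`. Then there is `m` such that every `conj_{γ₁}`-fixed class `s` of
`H¹_{nr,v̄}(K̃_∞, E[p^∞])` (`unrSelmer₂ κ₁ κ₂ E[p^∞] v̄`) has `p^m·s` in the range of the restriction from Castella's
`Sel_{v̄}^∅(K_∞^{(2)}, E[p^∞])` (`selmerAcToUnrSelmer₂`). GLOBAL: `s = res y` (sbc-p1 `exists_resOfLe_eq_of_conjSel₂_eq`); AWAY from `p`:
`I_v ≤ ker κ₁` so `y` is unramified where `res y` is (§1), and unramified ⟹ locally trivial after ONE integer `t` (sbc-p1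
`exists_nsmul_mem_selmerAc_of_mem_datumStrictSelmer`); AT `v̄`: §2; then Bézout on the `p`-primary class.
[cite: SkinnerUrban2014, §3.2.7 and Prop. 3.2.8 (p. 23)] [cite: JetchevSkinnerWan2017, §3.4 (arXiv:1512.06894 pp. 14–15)]
[cite: GreenbergLNM1716, §3 Lemmas 3.1–3.3] -/
theorem exists_pow_smul_mem_range_selmerAcToUnrSelmer₂ (hγ : ZpExtension.IsTopGeneratorPair κ₁ κ₂ γ₁ γ₂)
    (hKc : ∀ w : InfinitePlace K, w.IsComplex) (hK : ∀ P : W.toAffine.Point, p • P = 0 → P = 0)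
    (hvbar : ((p : ℕ) : 𝓞 K) ∈ vbar.asIdeal)
    (hfix : ∀ m : W.geomPrimaryTorsion p, (∀ x : absoluteGaloisGroup K,
      x ∈ ZpExtension.pairKer κ₁ κ₂ → x ∈ inertia vbar → x • m = m) → m = 0) :
    ∃ m : ℕ, ∀ s : unrSelmer₂ κ₁ κ₂ (W.geomPrimaryTorsion p) vbar,
      conjSel₂ κ₁ κ₂ (W.geomPrimaryTorsion p) vbar γ₁ s = s →
        p ^ m • s ∈ Set.range (W.selmerAcToUnrSelmer₂ p κ₁ κ₂ vbar) := by
  have hp : p.Prime := Fact.out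
  obtain ⟨t, ht0, ht⟩ := SignedBaseChangeAcDivAwayDiscrepancy.exists_nsmul_mem_selmerAc_of_mem_datumStrictSelmer
    W p κ₂ hKc hvbar
  refine ⟨t.factorization p, fun s hs ↦ ?_⟩
  -- GLOBAL: `s = res y`
  obtain ⟨y, hy⟩ := SignedBaseChangeAcDivControlCoker.exists_resOfLe_eq_of_conjSel₂_eq W hγ hK vbar s hs
  have hle := ZpExtension.pairKer_le_right κ₁ κ₂
  have hcomm : ∀ σ : absoluteGaloisGroup K, conjH1 (ZpExtension.pairKer κ₁ κ₂) (W.geomPrimaryTorsion p) σ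
      (resOfLe (W.geomPrimaryTorsion p) hle y) = resOfLe (W.geomPrimaryTorsion p) hle
        (conjH1 κ₂.kerSubgroup (W.geomPrimaryTorsion p) σ y) := fun σ ↦ by
    rw [← AddMonoidHom.comp_apply, ← resOfLe_comp_conjH1_holds (M := W.geomPrimaryTorsion p) hle σ,
      AddMonoidHom.comp_apply]
  have hsmem : resOfLe (W.geomPrimaryTorsion p) hle y ∈
      datumSelmer (ZpExtension.pairKer κ₁ κ₂) (W.geomPrimaryTorsion p) p
        (AcSelmer.bdpData (W.geomPrimaryTorsion p) p vbar) ∅ := by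
    have : W.resOfLe p hle y ∈ unrSelmer₂ κ₁ κ₂ (W.geomPrimaryTorsion p) vbar := by rw [hy]; exact s.2
    exact this
  rw [mem_datumSelmer_iff, mem_unramifiedOutside_iff] at hsmem
  obtain ⟨hunr, hgr⟩ := hsmem
  -- `y` lies in Greenberg–Vatsal's STRICT group over `K_∞^{(2)}`
  have hyStr : y ∈ datumStrictSelmer κ₂.kerSubgroup (W.geomPrimaryTorsion p) p
      (AcSelmer.bdpData (W.geomPrimaryTorsion p) p vbar) ∅ := by
    rw [mem_datumStrictSelmer_iff, mem_unramifiedOutside_iff]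
    refine ⟨fun v _ hpv σ ↦ ?_, fun v hv σ ↦ ?_⟩
    · -- AWAY from `p`: the inertia groups of `K̃_∞` and `K_∞^{(2)}` at `v` agree (`I_v ≤ ker κ₁`)
      have hI : κ₂.kerSubgroup ⊓ inertia v ≤ ZpExtension.pairKer κ₁ κ₂ := by
        have hI1 : inertia v ≤ κ₁.kerSubgroup := by
          have e : inertia v = (adicCompletionPrime K v).inertia (absoluteGaloisGroup K) :=
            (inertia_adicCompletionPrime_eq_map_absInertia K v).symm
          rw [e]
          exact ZpExtension.inertia_le_kerSubgroup_holds K p κ₁ hpv (adicCompletionPrime_mem_primesAbove K v)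
        rintro x ⟨hx2, hxI⟩
        exact ZpExtension.mem_pairKer_iff.2 ⟨ZpExtension.mem_kerSubgroup.1 (hI1 hxI), ZpExtension.mem_kerSubgroup.1 hx2⟩
      refine mem_unramifiedKer_of_resOfLe_mem hle v hI ?_
      rw [← hcomm]
      exact hunr v (Set.notMem_empty v) hpv σ
    · by_cases hvb : v = vbar
      · subst hvb
        rw [AcSelmer.bdpData_self p v hv]
        refine mem_strictKer_strictDatum_of_resOfLe_mem_greenbergKer hle v hfix ?_
        rw [← hcomm]
        have h2 := hgr v hv σ
        rwa [AcSelmer.bdpData_self p v hv] at h2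
      · rw [AcSelmer.bdpData_of_ne p vbar hv hvb, AcSelmer.strictKer_relaxedDatum_eq_top]
        exact AddSubgroup.mem_top _
  -- `t • y ∈ Sel_{v̄}^∅(K_∞^{(2)})`, hence `t • s ∈ range(res)`
  have hty : t • y ∈ AcSelmer.selmerAc W p κ₂ vbar ∅ := ht y hyStr
  have hts : t • s ∈ Set.range (W.selmerAcToUnrSelmer₂ p κ₁ κ₂ vbar) := by
    refine ⟨⟨t • y, hty⟩, Subtype.ext ?_⟩
    rw [WeierstrassCurve.coe_selmerAcToUnrSelmer₂_apply, AddSubgroup.coe_nsmul, map_nsmul, hy]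
  -- `s` is `p`-primary
  obtain ⟨k, hk⟩ : ∃ k : ℕ, p ^ k • s = 0 := by
    obtain ⟨k, hk⟩ := TwoVariableSelmer.exists_pow_smul_subgroupH1_pair_eq_zero κ₁ κ₂ (W.geomPrimaryTorsion p)
      (W.exists_pow_smul_geomPrimaryTorsion_eq_zero p) (s : W.subgroupH1 p (ZpExtension.pairKer κ₁ κ₂))
    exact ⟨k, Subtype.ext (by rw [AddSubgroupClass.coe_nsmul]; exact hk)⟩
  exact exists_pow_smul_mem_of_nsmul_mem p (W.selmerAcToUnrSelmer₂ p κ₁ κ₂ vbar).range ht0 hk hts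

end Tower

/-! ## §4. The `ℚ`-curve form (binders of the skeletons' `TameExactControlAt`, at a given pair) -/

section Rational

open Literature.NumberTheory.EllipticCurves.Rank1Residual

/-- **TAME EXACT CONTROL AT A GIVEN PAIR FROM THE LOCAL VANISHING** — the `ℚ`-curve form: `W/ℚ`, `p ≠ 2` with `ρ̄_{E,p}` onto
(`Surj W p`, so `E(K)[p] = 0` over the imaginary quadratic `K`, `torsionBy_eq_bot_of_isImaginaryQuadratic`), `K` imaginary quadratic,
`(κ₁, κ; γ₁, γ)` a topological generator pair, `𝔭′ ∋ p`, and `E[p^∞]^{Gal(K̄/K̃_∞) ∩ I_{𝔭′}} = 0`: there is `m` with `p^m·s ∈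
range(selmerAcToUnrSelmer₂)` for every `conj_{γ₁}`-fixed `s ∈ unrSelmer₂ κ₁ κ E_K[p^∞] 𝔭′` — the conclusion of
`TameExactControlAt W p K` at that pair. [cite: SkinnerUrban2014, Prop. 3.2.8 (p. 23)]
[cite: JetchevSkinnerWan2017, §3.4 (arXiv:1512.06894 pp. 14–15)] [cite: GrossLMS1991, §2 (after (2.2))] -/
theorem tameExactControl_of_localVanishing (W : WeierstrassCurve ℚ) [W.IsElliptic] (p : ℕ) [Fact p.Prime] (hp2 : p ≠ 2)
    (hsurj : Surj W p) (K : Type) [Field K] [NumberField K] (hK : IsImaginaryQuadratic K)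
    (κ₁ κ : ZpExtension K p) (γ₁ γ : absoluteGaloisGroup K) [hγ : Fact (ZpExtension.IsTopGeneratorPair κ₁ κ γ₁ γ)]
    (𝔭' : HeightOneSpectrum (𝓞 K)) (h𝔭' : ((p : ℕ) : 𝓞 K) ∈ 𝔭'.asIdeal)
    (hfix : ∀ m : (W.baseChange K).geomPrimaryTorsion p, (∀ x : absoluteGaloisGroup K,
      x ∈ ZpExtension.pairKer κ₁ κ → x ∈ inertia 𝔭' → x • m = m) → m = 0) :
    ∃ m : ℕ, ∀ s : unrSelmer₂ κ₁ κ ((W.baseChange K).geomPrimaryTorsion p) 𝔭',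
      conjSel₂ κ₁ κ ((W.baseChange K).geomPrimaryTorsion p) 𝔭' γ₁ s = s →
        p ^ m • s ∈ Set.range ((W.baseChange K).selmerAcToUnrSelmer₂ p κ₁ κ 𝔭') := by
  have hp : p.Prime := Fact.out
  haveI hEK : (W.baseChange K).IsElliptic := by rw [WeierstrassCurve.baseChange]; infer_instance
  haveI : IsTotallyComplex K := hK.2
  have hKc : ∀ w : InfinitePlace K, w.IsComplex := fun w ↦ IsTotallyComplex.isComplex w
  have htor := Literature.NumberTheory.EllipticCurves.torsionBy_eq_bot_of_isImaginaryQuadratic W K hK hp hp2 hsurj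
  have hKp : ∀ P : (W.baseChange K).toAffine.Point, p • P = 0 → P = 0 := fun P hP => by
    have hmem : P ∈ AddSubgroup.torsionBy (W.baseChange K).toAffine.Point (p : ℤ) :=
      AddSubgroup.torsionBy.nsmul_iff.mpr hP
    rw [htor] at hmem
    exact AddSubgroup.mem_bot.mp hmem
  exact exists_pow_smul_mem_range_selmerAcToUnrSelmer₂ (W.baseChange K) p κ₁ κ 𝔭' hγ.out hKc hKp h𝔭' hfix

end Rational

end Summit.BirchSwinnertonDyer.BirchSwinnertonDyer.Theorems.TameExactControl

end
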